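import Summits.Langlands.Langlands.Theses.FifteenLocusEisenstein
import Literature.NumberTheory.Automorphic.CaraianiNewtonIrreducibleFive
import Literature.NumberTheory.Automorphic.AlgebraicityTwist
import Literature.NumberTheory.Automorphic.AutomorphicTwistNorm
import Literature.NumberTheory.GaloisRepresentations.CyclotomicLevels
import HarnessLib

/-!
# Birth skeleton (BC3) for crux stmt-Langlands-16057
`Summit.Langlands.Langlands.Theses.FifteenLocusEisenstein.IrreducibleFiveModular` — line `birth`

Route `route-Langlands-FifteenLocusEisenstein` (rev 3; deciding theorem
`closes : IrreducibleFiveModular → NonOrdinaryEisensteinModular → UnorientedOrdinaryModular →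
ReducibleOrdinaryModular → OrientedOrdinaryOfEngine → SectorComplement → Langlands`).  The crux is
the route's INPUT item (rank 6): Caraiani–Newton 2023, Theorem 7.1 (1) — *F imaginary quadratic,
E/F (integral model over 𝓞 F, Δ ≠ 0, no geometric CM) with Γ_F acting irreducibly on E[5] ⇒ E is
modular*, with "modular" transported to the summit's L-normalised point-count clause
(`∃ π` L-algebraic cuspidal on `GL₂(𝔸_F)` with `Σ α⁻¹ = a_w(E)`, `∏ α⁻¹ = N w` at almost every `w`).

## The skeleton = the printed proof of Theorem 7.1 (1) (arXiv:2301.10509 v3, pp. 87–102)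

CN p. 93: "Combining Theorem 6.1 with Lemma 7.1.1, to prove Theorem 7.1 we need to show modularity
of the elliptic curves defined over imaginary quadratic fields giving rise to points of the
following modular curves: (1) X(ns3°, b5) (2) X(b3, ns5) (3) X(ns3°, ns5) (4) X(s3, ns5)."  For
clause (1) of Thm 7.1 (irreducible `E[5]`) the case tree is:

* `r̄_{E,5}|_{Γ_{F(ζ₅)}}` absolutely irreducible ⇒ **Cor. 6.1.1 (2)** (= Thm 6.1, the ordinary /
  potentially Barsotti–Tate automorphy lifting Thm 5.2 over CM fields with the crystalline torsion
  local–global compatibility Thm 4.2.15, seeded by the Allen–Khare–Thorne residual modularity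
  Props. 6.1.5/6.1.6 and closed by solvable descent; plus the Goursat/Dickson Lemma 6.2.2
  "absolutely irreducible on `Γ_{F(ζ_p)}` ⇒ decomposed generic" for quadratic `F`)
  — `stub_absIrredFive`;
* else, if `r̄_{E,3}|_{Γ_{F(ζ₃)}}` is absolutely irreducible ⇒ **Cor. 6.1.1 (1)** — `stub_absIrredThree`;
* else, by **Lemma 7.1.1 (3)** (`[F(ζ₅):F] = 4` for imaginary quadratic `F`) the mod-5 image lies in
  the normaliser of a non-split Cartan `C⁺_ns(5)`, and
  - if `E[3]` is REDUCIBLE (Borel at 3) the curve gives an `F`-point of `X(b3, ns5)` ⇒ modular by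
    **Cor. 7.3.4** (genus-2 curve, Prop. 7.3.1–7.3.3: `ℚ`-curves or the `ℚ(√−11)` points, which
    satisfy Cor. 6.1.1) — `stub_borelThreeNonsplitFive`;
  - if `E[3]` is irreducible but not absolutely irreducible on `Γ_{F(ζ₃)}`, **Lemma 7.1.1 (2)** puts
    the mod-3 image in `C⁺_s(3)` or inside `C_ns(3)`, i.e. an `F`-point of `X(s3, ns5)` or
    `X(ns3°, ns5)` ⇒ modular by **Cor. 7.4.6** (bi-elliptic quartics over `X(ns3, ns5) = 225A1`,
    relative symmetric Chabauty + Mordell–Weil sieve, Props. 7.4.3–7.4.5; the two exceptional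
    points over `ℚ(√−55)` have rational `j`) — `stub_cartanThreeNonsplitFive`.

Each stub concludes CN's own notion "E is modular" in the tree's Euler-factor rendering
`Literature.NumberTheory.Automorphic.IsModularEllipticCurveHecke F E` (geometric CM, or a
weight-zero cuspidal `π` on `GL₂(𝔸_F)` with Hecke polynomial `X² − a_w(E) X + q_w` at cofinitely
many `w`; the dictionary of the ACCEPTED named fact `CaraianiNewton2023_thm7_1_1_hecke`, p117601).
"Absolutely irreducible on `Γ_{F(ζ_p)}`" — for which the tree has no name yet — is rendered here by
`AbsIrredOnCyclotomic W p` (§0): no `Γ_{F(μ_p)}`-stable subgroup of `E[p]` other than `⊥, ⊤`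
(irreducible over `𝔽_p`; `Γ_{F(μ_p)}` = the tree's `rootsOfUnityFixer F p`, the kernel of the
mod-`p` cyclotomic character, `rootsOfUnityFixer_eq_ker`) AND the image of `Γ_{F(μ_p)}` in
`Aut(E[p])` is non-abelian — for a 2-dimensional `𝔽_p`-representation this is equivalent to
absolute irreducibility (an irreducible 2-dimensional representation with abelian image factors
through `𝔽_{p²}^× ⊂ GL₂(𝔽_p)`, a non-split Cartan, and splits over `𝔽_{p²}`; conversely a
representation irreducible over `𝔽_p` but reducible over `𝔽̄_p` has two Frobenius-conjugate
stable lines and hence abelian image).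

`IrreducibleFiveModular_of` (kernel-checked, no `sorry`; hypotheses = the four stub statements by
name via `_Goal.stub_x := type_of% @stub_x`): the case split above, then the HALF-TWIST TRANSPORT
from CN's weight-zero `π` to the summit's L-algebraic point-count clause, proved here in full
(`exists_lAlgebraic_pointCount_of_weightZero`): `π` of weight zero is regular algebraic
(`HasWeightZero.isRegularAlgebraic`), so `π' = π ⊗ |det|^{1/2}` is cuspidal and L-algebraic
(`CuspidalAutomorphicRepData.exists_twist_isRegular_isLAlgebraic`) with Satake parameters
`q_w^{-1/2} α` (`AutomorphicRepData.HasSatakeParamAt.of_map_mulChar_detTwist_of_cpow`); from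
`q_w^{1/2}(α₁ + α₂) = a_w(E)` and `q_w α₁α₂ = q_w` one reads `α₁α₂ = 1`, hence
`Σ (q_w^{-1/2}α_j)⁻¹ = q_w^{1/2}(α₁ + α₂) = a_w(E)` and `∏ (q_w^{-1/2}α_j)⁻¹ = q_w` — exactly the
crux's clause (this is the bookkeeping the grounder's candidate `Cand16057b.lean` performed modulo
the named fact; here it rides inside the composition, so the skeleton also certifies that
`CaraianiNewton2023_thm7_1_1_hecke` closes the crux: the final `example`).

`lean check`: sorries = the four stubs, nothing else.

Disproof used: none exists for this crux (`ledger crux ls stmt-Langlands-16057`, 2026-08-17: no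
workfiles; no `Theorems/IrreducibleFiveModular/Negative/`).  Dead lines: none recorded (first line).

References: A. Caraiani, J. Newton, arXiv:2301.10509 (2023/25): Thm 7.1, Lemma 7.1.1, Cor. 6.1.1,
Thm 6.1, Lemma 6.1.3, Lemma 6.2.2, Prop. 7.1.3, Cor. 7.3.4, Cor. 7.4.6 [CaraianiNewton2023];
P. Allen, C. Khare, J. Thorne, *Modularity of GL₂(𝔽_p)-representations over CM fields*
[AllenKhareThorne2021WeightOne]; N. Freitas, B. Le Hung, S. Siksek, Invent. Math. 201 (2015),
Lemma 2.2, Prop. 4.1 [FreitasLeHungSiksek2015]; K. Buzzard, T. Gee (2014) §5.3 (the `C ↔ L`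
half twist) [BuzzardGeeLMS2014]; J.-P. Serre, Invent. Math. 15 (1972), §2 (Cartan subgroups and
their normalisers; Prop. 15) [Serre1972].
-/

noncomputable section

set_option linter.dupNamespace false -- `Summit.Langlands.Langlands.…`: summit = sub-problem (D-0017 layout)

open scoped NumberField Classical
open Filter IsDedekindDomain NumberField
open Literature.NumberTheory.Automorphic Literature.NumberTheory.GaloisRepresentations
open Summit.Langlands.Langlands.Theses.FifteenLocusEisenstein (IrreducibleFiveModular)

namespace Summit.Langlands.Langlands.Cruxes.IrreducibleFiveModular.Birth

/-! ## 0. Vocabulary: absolute irreducibility of `E[p]` on `Γ_{F(ζ_p)}` -/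

/-- **`r̄_{E,p}|_{Γ_{F(ζ_p)}}` is absolutely irreducible** (the hypothesis of Caraiani–Newton
Cor. 6.1.1), rendered for the 2-dimensional `𝔽_p`-representation `E[p] = E(F̄)[p]` of
`Γ_{F(μ_p)} = rootsOfUnityFixer F p ≤ Γ_F`: (i) the only `Γ_{F(μ_p)}`-stable subgroups of `E[p]`
are `⊥` and `⊤` (irreducibility over `𝔽_p`, as in the tree's `HasIrreducibleModPGaloisRep`), and
(ii) two elements of `Γ_{F(μ_p)}` act on `E[p]` by non-commuting automorphisms (non-abelian image).
For a 2-dimensional representation over `𝔽_p`, (i) ∧ (ii) ⟺ absolute irreducibility.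
[cite: CaraianiNewton2023, Cor. 6.1.1 and Lemma 7.1.1] [cite: Serre1972, §2] -/
def AbsIrredOnCyclotomic {F : Type} [Field F] (W : WeierstrassCurve F) (p : ℕ) : Prop :=
  (∀ H : AddSubgroup (W.geomTorsion p),
      (∀ σ ∈ rootsOfUnityFixer F p, ∀ P ∈ H, σ • P ∈ H) → H = ⊥ ∨ H = ⊤) ∧
    ∃ σ ∈ rootsOfUnityFixer F p, ∃ τ ∈ rootsOfUnityFixer F p, ∃ P : W.geomTorsion p,
      σ • τ • P ≠ τ • σ • P

/-! ## 1. The four stubs (the ONLY sorries of this file) -/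

/-- **stub Cor. 6.1.1 (2) — the `p = 5` automorphy-lifting branch.** `F` imaginary quadratic
(`IsTotallyComplex ∧ finrank ℚ F = 2`), `E` an integral Weierstrass model over `𝓞 F` with `Δ ≠ 0`
whose mod-5 representation is absolutely irreducible on `Γ_{F(ζ₅)}` ⇒ `E` is modular
(`IsModularEllipticCurveHecke`: geometric CM, or a weight-zero cuspidal `π` on `GL₂(𝔸_F)` with Hecke
polynomial `X² − a_w(E)X + q_w` at cofinitely many `w`).  Printed: Cor. 6.1.1 (2) = Thm 6.1 (2)
(Thm 5.2 ordinary/pot-BT lifting over CM fields with `ζ₅ ∉ F` + AKT residual modularity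
Prop. 6.1.5 + Lemma 6.1.4 + solvable descent) + Lemma 6.2.2 (abs. irreducible on `Γ_{F(ζ₅)}` ⇒
decomposed generic, `F/ℚ` quadratic); the Euler factor at good `w` from `r_{π,ι} ≅ r_{E,p}^∨` and
Lemma 6.1.3 (1) (trivial central character).  Why it might fail: formalization debt only (XL);
as typed, a slip in the rendering `AbsIrredOnCyclotomic` (it is implied by, not weaker than, the
printed hypothesis) would make it unprovable from the paper, not false.
[cite: CaraianiNewton2023, Cor. 6.1.1 (2), Thm. 6.1, Lemma 6.2.2, Lemma 6.1.3]
[cite: AllenKhareThorne2021WeightOne] -/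
theorem stub_absIrredFive : ∀ (F : Type) [Field F] [NumberField F], IsTotallyComplex F →
    Module.finrank ℚ F = 2 → ∀ (E : WeierstrassCurve (𝓞 F)), E.Δ ≠ 0 →
    AbsIrredOnCyclotomic (E.baseChange F) 5 → IsModularEllipticCurveHecke F E := by
  sorry

/-- **stub Cor. 6.1.1 (1) — the `p = 3` automorphy-lifting branch.** Same with the mod-3
representation absolutely irreducible on `Γ_{F(ζ₃)}` (for `F = ℚ(ζ₃)` this is `Γ_F` itself).
Printed: Cor. 6.1.1 (1) = Thm 6.1 (1) (Prop. 6.1.6 at `p = 3`) + Lemma 6.2.2.  Why it might fail: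
formalization debt only (XL).  [cite: CaraianiNewton2023, Cor. 6.1.1 (1), Thm. 6.1, Prop. 6.1.6]
[cite: AllenKhareThorne2021WeightOne] -/
theorem stub_absIrredThree : ∀ (F : Type) [Field F] [NumberField F], IsTotallyComplex F →
    Module.finrank ℚ F = 2 → ∀ (E : WeierstrassCurve (𝓞 F)), E.Δ ≠ 0 →
    AbsIrredOnCyclotomic (E.baseChange F) 3 → IsModularEllipticCurveHecke F E := by
  sorry

/-- **stub `X(b3, ns5)` — Lemma 7.1.1 (3) + Cor. 7.3.4.** `F` imaginary quadratic, `E/𝓞 F` with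
`Δ ≠ 0`, `E[5]` irreducible over `𝔽₅` but NOT absolutely irreducible on `Γ_{F(ζ₅)}`, and `E[3]`
REDUCIBLE ⇒ `E` is modular.  Printed route: `det r̄_{E,5} = ε̄₅` and `[F(ζ₅):F] = 4`, so Lemma
7.1.1 (3) puts `r̄_{E,5}(Γ_F)` inside `C⁺_ns(5)`; with a Borel at 3 the curve is an `F`-point of
`X(b3, ns5)`, a genus-2 curve whose imaginary quadratic points are `ℚ`-curves (`σ(P) = w₃(P)`) or
the two `ℚ(√−11)`-points of Prop. 7.3.3, which satisfy Cor. 6.1.1 (Cor. 7.3.4).  Why it might fail: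
formalization debt (L/XL: Magma-certified Mumford representations of `Jac(C)(ℚ)`, modularity of
`ℚ`-curves over imaginary quadratic fields); false as typed only through the `AbsIrredOnCyclotomic`
rendering.  [cite: CaraianiNewton2023, Lemma 7.1.1 (3), Prop. 7.3.1–7.3.3, Cor. 7.3.4]
[cite: FreitasLeHungSiksek2015, Lemma 2.2 and Prop. 4.1] -/
theorem stub_borelThreeNonsplitFive : ∀ (F : Type) [Field F] [NumberField F], IsTotallyComplex F →
    Module.finrank ℚ F = 2 → ∀ (E : WeierstrassCurve (𝓞 F)), E.Δ ≠ 0 →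
    (E.baseChange F).HasIrreducibleModPGaloisRep 5 → ¬ AbsIrredOnCyclotomic (E.baseChange F) 5 →
    ¬ (E.baseChange F).HasIrreducibleModPGaloisRep 3 → IsModularEllipticCurveHecke F E := by
  sorry

/-- **stub `X(s3, ns5) ∪ X(ns3°, ns5)` — Lemma 7.1.1 (2),(3) + Cor. 7.4.6.** `F` imaginary
quadratic, `E/𝓞 F` with `Δ ≠ 0`, `E[5]` irreducible but not absolutely irreducible on `Γ_{F(ζ₅)}`,
`E[3]` irreducible but not absolutely irreducible on `Γ_{F(ζ₃)}` ⇒ `E` is modular.  Printed route: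
Lemma 7.1.1 (3) gives `C⁺_ns(5)` at 5 and Lemma 7.1.1 (2) gives `C⁺_s(3)` or a subgroup of `C_ns(3)`
at 3, i.e. an `F`-point of `X(s3, ns5)` or `X(ns3°, ns5)`; both are bi-elliptic over
`X(ns3, ns5) ≅ 225A1` (Prop. 7.1.3 (5), 7.4.3), and relative symmetric Chabauty + the Mordell–Weil
sieve (Props. 7.4.4–7.4.5) show every imaginary quadratic point is a pull-back of a rational point
or one of `P₁, P₂ ∈ X(s3, ns5)(ℚ(√−55))` with rational `j` (Cor. 7.4.6).  Why it might fail: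
formalization debt (L/XL: certified Chabauty/sieve output, modularity of `ℚ`-curves); false as
typed only through the rendering.  [cite: CaraianiNewton2023, Lemma 7.1.1, Prop. 7.1.3 (5), Props. 7.4.3–7.4.5, Cor. 7.4.6] -/
theorem stub_cartanThreeNonsplitFive : ∀ (F : Type) [Field F] [NumberField F], IsTotallyComplex F →
    Module.finrank ℚ F = 2 → ∀ (E : WeierstrassCurve (𝓞 F)), E.Δ ≠ 0 →
    (E.baseChange F).HasIrreducibleModPGaloisRep 5 → ¬ AbsIrredOnCyclotomic (E.baseChange F) 5 →
    (E.baseChange F).HasIrreducibleModPGaloisRep 3 → ¬ AbsIrredOnCyclotomic (E.baseChange F) 3 →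
    IsModularEllipticCurveHecke F E := by
  sorry

/-! ## 2. The stub statements as named propositions (hypotheses of the composition, by stub name)

Each `_Goal.stub_x` is `type_of% @stub_x`: literally the stub's statement, no text duplicated, no
`sorry` inherited. -/

namespace _Goal

/-- The statement of `stub_absIrredFive` (literally its type). [folklore] -/
def stub_absIrredFive : Prop :=
  type_of% @Summit.Langlands.Langlands.Cruxes.IrreducibleFiveModular.Birth.stub_absIrredFive

/-- The statement of `stub_absIrredThree` (literally its type). [folklore] -/
def stub_absIrredThree : Prop :=
  type_of% @Summit.Langlands.Langlands.Cruxes.IrreducibleFiveModular.Birth.stub_absIrredThree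

/-- The statement of `stub_borelThreeNonsplitFive` (literally its type). [folklore] -/
def stub_borelThreeNonsplitFive : Prop :=
  type_of% @Summit.Langlands.Langlands.Cruxes.IrreducibleFiveModular.Birth.stub_borelThreeNonsplitFive

/-- The statement of `stub_cartanThreeNonsplitFive` (literally its type). [folklore] -/
def stub_cartanThreeNonsplitFive : Prop :=
  type_of% @Summit.Langlands.Langlands.Cruxes.IrreducibleFiveModular.Birth.stub_cartanThreeNonsplitFive

end _Goal

/-! ## 3. The half-twist transport (proved): weight-zero `π` ⟹ L-algebraic point counts -/

/-- `q_w^{-1/2}` as the complex power appearing in `of_map_mulChar_detTwist_of_cpow` for the twist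
`|det|^{(2-1)/2}` is the inverse of the real square root `√q_w`. [folklore] -/
theorem residueCard_cpow_neg_half {F : Type} [Field F] [NumberField F]
    (w : HeightOneSpectrum (𝓞 F)) :
    (w.residueCard : ℂ) ^ (-(((((2 : ℕ) : ℝ) - 1) / 2 : ℝ) : ℂ)) =
      (((Real.sqrt (w.residueCard : ℝ) : ℝ) : ℂ))⁻¹ := by
  have hhalf : ((((2 : ℕ) : ℝ) - 1) / 2 : ℝ) = 1 / 2 := by norm_num
  rw [Complex.cpow_neg, hhalf, ← Complex.ofReal_natCast,
    ← Complex.ofReal_cpow (Nat.cast_nonneg _), ← Real.sqrt_eq_rpow]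

/-- **Half-twist transport.** A cuspidal `π` on `GL₂(𝔸_F)` of weight zero whose Satake parameters
satisfy `q_w^{1/2} Σ α = a_w(E)` and `q_w ∏ α = q_w` at cofinitely many `w` (CN's "modular",
Euler-factor form) yields the L-algebraic cuspidal `π' = π ⊗ |det|^{1/2}` with
`Σ_j β_j⁻¹ = a_w(E)` and `∏_j β_j⁻¹ = q_w` for its Satake parameters `β = q_w^{-1/2} α` at the same
places (Buzzard–Gee's `C ↔ L` twist; `α₁α₂ = 1` turns `Σ β⁻¹` into `q_w^{1/2} Σ α`).
[cite: BuzzardGeeLMS2014, §5.3] [cite: CaraianiNewton2023, Lemma 6.1.3 (1)] -/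
theorem exists_lAlgebraic_pointCount_of_weightZero {F : Type} [Field F] [NumberField F]
    {hL : isCompact_glFiniteIntegralLevel 2 F} (π : CuspidalAutomorphicRepData 2 F hL)
    (h0 : π.1.HasWeightZero) (E : WeierstrassCurve (𝓞 F))
    (hH : ∀ᶠ w : HeightOneSpectrum (𝓞 F) in cofinite, ∃ α : Multiset ℂ,
      π.1.HasSatakeParamAt w α ∧
        ((Real.sqrt (w.residueCard : ℝ) : ℝ) : ℂ) * α.sum = (frobTraceAt E w : ℂ) ∧
        ((Real.sqrt (w.residueCard : ℝ) : ℝ) : ℂ) ^ 2 * α.prod = (w.residueCard : ℂ)) :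
    ∃ π' : CuspidalAutomorphicRepData 2 F hL, π'.1.IsLAlgebraic ∧
      ∀ᶠ w : HeightOneSpectrum (𝓞 F) in cofinite, ∃ β : Multiset ℂ,
        π'.1.HasSatakeParamAt w β ∧ (β.map fun a => a⁻¹).sum = (frobTraceAt E w : ℂ) ∧
          (β.map fun a => a⁻¹).prod = (w.residueCard : ℂ) := by
  obtain ⟨χ, π', T', hχ, hW, hW', hT', -, hLalg⟩ :=
    π.exists_twist_isRegular_isLAlgebraic h0.isRegularAlgebraic
  refine ⟨π', ⟨T', hT', hLalg⟩, ?_⟩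
  filter_upwards [hH] with w hw
  obtain ⟨α, hα, hsum, hprod⟩ := hw
  have hβ := AutomorphicRepData.HasSatakeParamAt.of_map_mulChar_detTwist_of_cpow hχ hW hW' hα
  rw [residueCard_cpow_neg_half] at hβ
  refine ⟨_, hβ, ?_⟩
  obtain ⟨a, b, rfl⟩ := Multiset.card_eq_two.1 hα.card_eq
  set r : ℂ := ((Real.sqrt (w.residueCard : ℝ) : ℝ) : ℂ) with hr_def
  have hr : r ≠ 0 := sqrt_residueCard_ne_zero w
  have hr2 : r ^ 2 = (w.residueCard : ℂ) := by
    rw [hr_def, ← Complex.ofReal_pow, Real.sq_sqrt (Nat.cast_nonneg _), Complex.ofReal_natCast]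
  have hq : (w.residueCard : ℂ) ≠ 0 := by rw [← hr2]; exact pow_ne_zero _ hr
  rw [Multiset.insert_eq_cons, Multiset.sum_cons, Multiset.sum_singleton] at hsum
  rw [Multiset.insert_eq_cons, Multiset.prod_cons, Multiset.prod_singleton, hr2] at hprod
  have hab : a * b = 1 := by
    have h1 : (w.residueCard : ℂ) * (a * b) = (w.residueCard : ℂ) * 1 := by rw [mul_one]; exact hprod
    exact mul_left_cancel₀ hq h1
  have hainv : a⁻¹ = b := inv_eq_of_mul_eq_one_right hab
  have hbinv : b⁻¹ = a := inv_eq_of_mul_eq_one_left hab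
  simp only [Multiset.insert_eq_cons, Multiset.map_cons, Multiset.map_singleton, Multiset.sum_cons,
    Multiset.sum_singleton, Multiset.prod_cons, Multiset.prod_singleton, mul_inv, inv_inv, hainv,
    hbinv]
  constructor
  · linear_combination hsum
  · linear_combination (a * b) * hr2 + (w.residueCard : ℂ) * hab

/-! ## 4. The composition (kernel-checked, no `sorry`):
Cor 6.1.1 (2) → Cor 6.1.1 (1) → Cor 7.3.4 → Cor 7.4.6 → IrreducibleFiveModular -/

/-- **Theorem 7.1 (1) in CN's own dictionary from the four branches** (the printed case tree of
§7.1: Cor. 6.1.1 at 5, else at 3, else Lemma 7.1.1 + the small modular curves).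
[cite: CaraianiNewton2023, Thm. 7.1 (1) and its proof, p. 93] -/
theorem thm7_1_1_hecke_of (h5 : _Goal.stub_absIrredFive) (h3 : _Goal.stub_absIrredThree)
    (hB : _Goal.stub_borelThreeNonsplitFive) (hC : _Goal.stub_cartanThreeNonsplitFive) :
    CaraianiNewton2023_thm7_1_1_hecke := by
  dsimp only [_Goal.stub_absIrredFive, _Goal.stub_absIrredThree, _Goal.stub_borelThreeNonsplitFive,
    _Goal.stub_cartanThreeNonsplitFive] at h5 h3 hB hC
  intro F _ _ hF hdeg E hΔ hirr
  by_cases H5 : AbsIrredOnCyclotomic (E.baseChange F) 5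
  · exact h5 F hF hdeg E hΔ H5
  by_cases H3 : AbsIrredOnCyclotomic (E.baseChange F) 3
  · exact h3 F hF hdeg E hΔ H3
  by_cases hirr3 : (E.baseChange F).HasIrreducibleModPGaloisRep 3
  · exact hC F hF hdeg E hΔ hirr H5 hirr3 H3
  · exact hB F hF hdeg E hΔ hirr H5 hirr3

/-- **`IrreducibleFiveModular` from its four stubs.**  Hypotheses = the four stub statements by
name; conclusion = the route decl by name.  The case tree gives Theorem 7.1 (1) in CN's dictionary
(`thm7_1_1_hecke_of`); for a non-CM curve this is a weight-zero `π` with `q_w^{1/2} Σ α = a_w(E)`,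
`q_w ∏ α = q_w` cofinitely (`CaraianiNewton2023_thm7_1_1_hecke.exists_hasSatakeParamAt`, a proved
reading of the definition), and the half-twist transport lands on the crux's clause; the level
witnesses `hL`/`hcpt` are proofs of one `Prop`, so `π'` retypes definitionally.
[cite: CaraianiNewton2023, Thm. 7.1 (1) and Lemma 6.1.3 (1)] -/
theorem IrreducibleFiveModular_of (h5 : _Goal.stub_absIrredFive) (h3 : _Goal.stub_absIrredThree)
    (hB : _Goal.stub_borelThreeNonsplitFive) (hC : _Goal.stub_cartanThreeNonsplitFive) :
    IrreducibleFiveModular := by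
  intro F _ _ hF hdeg E hΔ hCM hirr hcpt
  obtain ⟨hL, π, h0, hH⟩ := (thm7_1_1_hecke_of h5 h3 hB hC).exists_hasSatakeParamAt hF hdeg hΔ hCM hirr
  exact exists_lAlgebraic_pointCount_of_weightZero π h0 E hH

/-- **By-product (an `example`, deliberately not a declaration, so that the skeleton registry sees
exactly one theorem concluding the crux): the accepted named fact closes the crux** — Theorem 7.1 (1)
in Euler-factor rendering for a non-CM curve followed by the half-twist transport; the reduction of
the grounder's candidate `Cand16057b.lean`.  A prover may land it verbatim as
`theorem … (h : CaraianiNewton2023_thm7_1_1_hecke) : IrreducibleFiveModular` in a Theorems file.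
[cite: CaraianiNewton2023, Thm. 7.1 (1) and Lemma 6.1.3] -/
example (h : CaraianiNewton2023_thm7_1_1_hecke) : IrreducibleFiveModular := by
  intro F _ _ hF hdeg E hΔ hCM hirr hcpt
  obtain ⟨hL, π, h0, hH⟩ := h.exists_hasSatakeParamAt hF hdeg hΔ hCM hirr
  exact exists_lAlgebraic_pointCount_of_weightZero π h0 E hH

/-- By-name sanity check (an `example`, not a declaration): the four stubs feed the composition as
they stand. -/
example : IrreducibleFiveModular :=
  IrreducibleFiveModular_of stub_absIrredFive stub_absIrredThree stub_borelThreeNonsplitFive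
    stub_cartanThreeNonsplitFive

end Summit.Langlands.Langlands.Cruxes.IrreducibleFiveModular.Birth

end
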